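import Literature.NumberTheory.EllipticCurves.KatoFineSelmerDual
import Literature.NumberTheory.EllipticCurves.FineSelmerTorsionCoefficientsFiniteProofs
import Literature.NumberTheory.EllipticCurves.IwasawaModuleFinitePadicIntProofs
import HarnessLib

/-!
# Lim–Sujatha 2018, Prop. 3.2: Coates–Sujatha's statement (A) (the dual fine Selmer group over the
# cyclotomic `ℤ_p`-extension is finitely generated over `ℤ_p`) is an invariant of the residual Galois
# module `E[p]` — for elliptic curves over `ℚ` (ONE named fact, statement only; weaker than print)

Topic `NumberTheory/EllipticCurves` (namespace = path, sub-namespace `LimSujatha2018` for the paper).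
Written by the prover seat `bsd-potss-k9-c4` (cell `bsd-potss`, rung K9 of `BirchSwinnertonDyer`,
crux stmt-BirchSwinnertonDyer-19386 `WildFineSelmerCoatesSujatha` = statement (A) at `(E,3)` on the
irreducible tower-non-surjective wild rows) to NAME the printed input of the CONGRUENCE ROAD to that
crux: (A) at `(E,p)` follows from (A) at `(E′,p)` for ANY congruent curve `E′` (`E′[p] ≅ E[p]`), so a
row is discharged by one congruent curve on which (A) is known (a Kato unit anchor — cell `b2b-bsdres`
lane o6-r1, `Summits/…/O6/X4CongruenceAnchor.lean`, where this proposition was typed over an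
uninstantiated interface `FineMuZero` as the hypothesis-tagged declaration `O6.FineMuZeroCongruenceInvariant`
because the tree then had no fine-Selmer object — or a good ordinary curve with classical `μ = 0`).
Nothing is asserted; no `_holds` (the proof is Poitou–Tate + `H²(G_S(F^cyc), A[π])`, size L).

## Source (held text `paper:arxiv-1603.08640`, = J. Number Theory 187 (2018) 66–91, §3; read 2026-08-26)

M. F. Lim, R. Sujatha, *Fine Selmer groups of congruent Galois representations*. §3 (p. 8 of the
de-TeXed text): `F` a number field, `K/ℚ_p` finite with integers `𝒪` and uniformiser `π`, `V` a
finite-dimensional `K`-representation of `Gal(F̄/F)` unramified outside a finite set, `T ⊂ V` a stable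
lattice, `A = V/T`; `S` a finite set of primes of `F` containing the primes above `p`, the ramified
primes of `A` (and of `B` below) and the infinite primes; for `𝓛 ⊂ F_S`,
"`R_S(A/𝓛) = ker (H¹(G_S(𝓛), A) → ⊕_{v ∈ S} K¹_v(A/𝓛))`" with `K¹_v(A/L) = ⊕_{w ∣ v} H¹(L_w, A)`,
"We shall write `Y_S(A/𝓛)` for the Pontryagin dual `R_S(A/𝓛)^∨` of the fine Selmer group."
**Statement (A)** (loc. cit., displayed and so labelled after Coates–Sujatha): "For any number field `F`, `Y_S(A/F^cyc)` is a finitely generated `𝒪`-module."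
**Proposition 3.2** (arXiv v3 numbering; the TeX label is `fg cong`; it is the second numbered
statement of §3, after Thm. 3.1 = the Coates–Sujatha `p`-extension criterion): "Suppose that there
is an isomorphism `A[π] ≅ B[π]` of `G_S(F)`-modules. Then [(A)] holds for `Y_S(A/F^cyc)` if
and only if [(A)] holds for `Y_S(B/F^cyc)`."  Earlier statement for elliptic curves:
R. Sujatha, Dev. Math. 18 (the `μ = 0` paper), in: Quadratic forms, linear algebraic
groups, and cohomology, Dev. Math. 18, Springer (2010), 125–135 (cited as [Suj10] in arXiv:2502.00621,
p. 2: "[(A)] is known to be invariant among residually isomorphic elliptic curves over the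
cyclotomic `ℤ_p`-extension [Suj10, FS18]").

## Transcription (the special case the tree has language for; weaker than print, never stronger)

`F = ℚ`; `A = E₁[p^∞]`, `B = E₂[p^∞]` for ELLIPTIC curves `E₁, E₂/ℚ` given by Weierstrass models
`W₁, W₂` (`𝒪 = ℤ_p`, `π = p`, `V = V_pEᵢ`, `T = T_pEᵢ`, `A[π] = Eᵢ[p]`); the isomorphism
`E₁[p] ≅ E₂[p]` of `G_S(ℚ)`-modules spelled as a `Γ_ℚ`-equivariant additive isomorphism of the
geometric `p`-torsion `geomTorsion Wᵢ p` (the tree's idiom, as in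
`GreenbergVatsal2000.thm14_mainConjecture_transfer_of_torsionIso`; a `Γ_ℚ`-module unramified outside
`S` is the same as a `G_S(ℚ)`-module); `F^cyc` = a `ℤ_p`-extension datum `κ : ZpExtension ℚ p` with
`κ.IsCyclotomic`; "`Y(Eᵢ/ℚ^cyc)` is finitely generated over `ℤ_p`" in the `∃`-form over the tree's
Pontryagin-dual data `WeierstrassCurve.FineSelmerDualData Wᵢ κ γ` of the tree's fine Selmer group
`WeierstrassCurve.fineSelmerInfty` (`KatoFineSelmerDual`: the classes of `H¹(ℚ^cyc, E[p^∞])` locally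
trivial at EVERY place).  Over `ℚ^cyc` this is `R_S(A/ℚ^cyc)` for every admissible `S`: a class
locally trivial outside `S` is unramified outside `S`, and conversely at a place `w ∤ p` of `ℚ^cyc` of
good reduction `H¹_nr(ℚ^cyc_w, E[p^∞]) = H¹(Gal(k̄/k_w), E[p^∞]) = 0`, the residue field `k_w` of
`ℚ^cyc_w` containing the `ℤ_p`-extension of `𝔽_ℓ` so that `Gal(k̄/k_w)` is pro-prime-to-`p`.  Any two
dual data are `ℤ_p`-linearly isomorphic (the ∃-form and the ∀-canonical form agree:
`Summit.….FineSelmerCanonicalNode.exists_fineSelmerDualData_finite_iff_forall_canonical`, k8t-c4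
p439726), so the `∃ γ D` spelling is faithful.  The biconditional is kept as printed.  `p ≠ 2`: §3 of
the source opens with "As before, `p` denotes a prime. Let `F` be a number field. If `p = 2`, assume
further that the number field `F` has no real primes" (p. 8, L3–5); `ℚ` has a real prime, so the
printed proposition does not cover `(ℚ, 2)` and the transcription carries `p ≠ 2` (review of the first
filing, p443913).
`-- TODO(general form): number fields F, Galois representations A = V/T with coefficients 𝒪 ⊂ K/ℚ_p finite.`

References: [LimSujatha2018] §3, statement (A) and Prop. 3.2; [CoatesSujatha2005] statement (A), §3;
[GreenbergVatsal2000] Thm. (1.4) (the ordinary-Selmer precedent).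
-/

noncomputable section

open scoped Classical

namespace Literature.NumberTheory.EllipticCurves.LimSujatha2018

open _root_.WeierstrassCurve

/-- **Lim–Sujatha 2018, Prop. 3.2 (Coates–Sujatha's statement (A) is an invariant of the residual
representation), for elliptic curves over `ℚ`.** M. F. Lim, R. Sujatha, J. Number Theory 187 (2018) 66–91, §3, Prop. 3.2
(arXiv:1603.08640 p. 8): "Suppose that there is an isomorphism `A[π] ≅ B[π]` of `G_S(F)`-modules.
Then [(A)] holds for `Y_S(A/F^cyc)` if and only if [(A)] holds for `Y_S(B/F^cyc)`",
(A) being the statement "`Y_S(A/F^cyc)` is a finitely generated `𝒪`-module" for the Pontryagin dual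
`Y_S` of the fine Selmer group `R_S(A/F^cyc) = ker (H¹(G_S(F^cyc), A) → ⊕_{v∈S} K¹_v(A/F^cyc))`.
Transcription (module docstring): `F = ℚ`, `A = E₁[p^∞]`, `B = E₂[p^∞]` for elliptic `W₁, W₂/ℚ`, the
`G_S(ℚ)`-isomorphism `E₁[p] ≅ E₂[p]` as a `Γ_ℚ`-equivariant additive isomorphism of `geomTorsion`,
`F^cyc` a cyclotomic `ZpExtension` datum `κ`, and "`Y(Eᵢ/ℚ^cyc)` f.g. over `ℤ_p`" in the `∃`-form
over `WeierstrassCurve.FineSelmerDualData Wᵢ κ γ` (dual of the everywhere-locally-trivial classes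
`WeierstrassCurve.fineSelmerInfty`, = `R_S` over `ℚ^cyc` for every admissible `S`), and `p ≠ 2`:
the source's §3 opens (p. 8, L3–5) with the standing assumption "If `p = 2`, assume further that the
number field `F` has no real primes", which excludes `(F, p) = (ℚ, 2)` — so the binder `p ≠ 2` is part
of the printed hypothesis, not a weakening of ours. Weaker than print (special case); nothing asserted;
no `_holds`.
`-- TODO(general form): number fields F (totally imaginary if p = 2) and Galois representations A = V/T over 𝒪.`
[cite: LimSujatha2018, §3 Prop. 3.2 and the displayed statement (A) (arXiv:1603.08640 p. 8; J. Number Theory 187 (2018) 66–91)]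
[cite: CoatesSujatha2005, statement (A) (§3)] -/
def prop32_fineSelmerDual_moduleFinite_iff_of_torsionIso : Prop :=
  ∀ (W₁ W₂ : WeierstrassCurve ℚ) [W₁.IsElliptic] [W₂.IsElliptic] (p : ℕ) [Fact p.Prime],
    p ≠ 2 →
    (∃ e : geomTorsion W₁ (p : ℤ) ≃+ geomTorsion W₂ (p : ℤ),
      ∀ (σ : Field.absoluteGaloisGroup ℚ) (P : geomTorsion W₁ (p : ℤ)), e (σ • P) = σ • e P) →
    ∀ (κ : ZpExtension ℚ p), κ.IsCyclotomic →
      ((∃ (γ : Field.absoluteGaloisGroup ℚ) (D : W₁.FineSelmerDualData κ γ),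
          Module.Finite ℤ_[p] (RestrictScalars ℤ_[p] (IwasawaAlgebra p) D.X)) ↔
        ∃ (γ : Field.absoluteGaloisGroup ℚ) (D : W₂.FineSelmerDualData κ γ),
          Module.Finite ℤ_[p] (RestrictScalars ℤ_[p] (IwasawaAlgebra p) D.X))

/-! ## Discharge (appended 2026-08-27, seat `bsd-potss-conjA-anchor` g5; D-0014: the fact stays a `def`,
users' `(h : prop32_…)` are fed `prop32_…_holds`)

The printed proof (Lim–Sujatha 2018 §3; Greenberg LNM 1716 §1, §3), in four sorry-free sibling files:
* `IwasawaModuleFinitePadicIntProofs`: (A) for `Sel₀(ℚ_∞, Eᵢ[p^∞])` ⟺ `Sel₀(ℚ_∞, Eᵢ[p^∞])[p]` finite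
  (Pontryagin duality + "`X/pX` finite ⟹ `X` torsion, `μ = 0`, f.g. over `ℤ_p`");
* `FineSelmerCoefficientMapProofs` (⟹) and `FineSelmerTorsionCoefficientsFiniteProofs` (⟸, using
  `CyclotomicLocalTorsionDivisibleProofs` at the good places and the order-`≤ 2` decomposition groups at
  the infinite places, `p` odd): `Sel₀(ℚ_∞, Eᵢ[p^∞])[p]` finite ⟺ `Sel₀(ℚ_∞, Eᵢ[p])` finite;
* `FineSelmerCoefficientMapProofs`: `Sel₀(ℚ_∞, E₁[p]) ≃ Sel₀(ℚ_∞, E₂[p])` along the `Γ_ℚ`-isomorphism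
  `E₁[p] ≅ E₂[p]` (transport of structure). -/

/-- **Discharge of `prop32_fineSelmerDual_moduleFinite_iff_of_torsionIso`** (Lim–Sujatha 2018,
Prop. 3.2, for elliptic curves over `ℚ`, `p ≠ 2`): statement (A) for `E₁` at `p` over the cyclotomic
`ℤ_p`-extension holds iff it holds for `E₂`, whenever `E₁[p] ≅ E₂[p]` as `Γ_ℚ`-modules. Proof as
printed: (A) ⟺ `Sel₀(ℚ_∞, E[p^∞])[p]` finite ⟺ `Sel₀(ℚ_∞, E[p])` finite, and the last group depends
only on the Galois module `E[p]`. [cite: LimSujatha2018, §3 Prop. 3.2 (arXiv:1603.08640 p. 8; J. Number Theory 187 (2018) 66–91)] -/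
theorem prop32_fineSelmerDual_moduleFinite_iff_of_torsionIso_holds :
    prop32_fineSelmerDual_moduleFinite_iff_of_torsionIso := by
  intro W₁ W₂ _ _ p _ hp he κ hκ
  obtain ⟨e, he⟩ := he
  obtain ⟨γ₀, hγ₀⟩ : ∃ γ : Field.absoluteGaloisGroup ℚ, κ.IsTopGenerator γ :=
    κ.surjective (Multiplicative.ofAdd 1)
  rw [IwasawaModuleFinitePadicInt.exists_fineSelmerDualData_moduleFinite_iff_finite_pTorsion W₁ κ hγ₀,
    IwasawaModuleFinitePadicInt.exists_fineSelmerDualData_moduleFinite_iff_finite_pTorsion W₂ κ hγ₀]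
  have h₁ : Set.Finite {s : W₁.fineSelmerInfty κ | p • s = 0} ↔
      (GreenbergSelmer.fineSelmerInfty (↥(W₁.geomTorsion (p : ℤ))) κ :
        Set (subgroupH1 κ.kerSubgroup (W₁.geomTorsion (p : ℤ)))).Finite :=
    ⟨FineSelmerCoefficientMap.finite_fineSelmerInfty_torsion_of_finite_pTorsion W₁ κ,
      FineSelmerCoefficientMap.finite_fineSelmerInfty_pTorsion_of_finite_torsion W₁ κ hκ hp⟩
  have h₂ : Set.Finite {s : W₂.fineSelmerInfty κ | p • s = 0} ↔
      (GreenbergSelmer.fineSelmerInfty (↥(W₂.geomTorsion (p : ℤ))) κ :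
        Set (subgroupH1 κ.kerSubgroup (W₂.geomTorsion (p : ℤ)))).Finite :=
    ⟨FineSelmerCoefficientMap.finite_fineSelmerInfty_torsion_of_finite_pTorsion W₂ κ,
      FineSelmerCoefficientMap.finite_fineSelmerInfty_pTorsion_of_finite_torsion W₂ κ hκ hp⟩
  rw [h₁, h₂]
  exact FineSelmerCoefficientMap.finite_fineSelmerInfty_iff_of_addEquiv κ e he

end Literature.NumberTheory.EllipticCurves.LimSujatha2018

end
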